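/-
Origin: expansion seat `planner-pub-hodgecm-qw8-g10-0`, handover #3b (md5 8ea1cec61db5, 331 l.): NEW additive leaf; imports Mathlib + #3a + #2 => TWO rewrites `import Qw8g10.LefNonNormalField` -> `import HodgeCM.Model.Toy.LefNonNormalField`, `import Qw8g10.LefExamples` -> `import HodgeCM.Model.Toy.LefExamples`; land AFTER #1, #2, #3a; frozen copy handover/LefNonNormalExample.8ea1cec61db5.lean (`HOME/pub-hodgecm-qw8-g10/lean/Qw8g10/LefNonNormalExample.lean`, md5 8ea1cec6, 331 lines);
landed by the gen-8 packager in gate run 31 as `HodgeCM/Model/Toy/LefNonNormalExample.lean` (import ^import Qw8g10\.LefExamples[ \t]*$→import HodgeCM.Model.Toy.LefExamples ×1; import ^import Qw8g10\.LefNonNormalField[ \t]*$→import HodgeCM.Model.Toy.LefNonNormalField ×1).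
-/
-- HANDOVER (planner-pub-hodgecm-qw8-g10-0, unit pub-hodgecm-qw8-g10): WIP module `Qw8g10.LefNonNormalExample`; intended
-- final module `HodgeCM.Model.Toy.LefNonNormalExample` (kind L5, separating model — decided instances); NEW additive leaf; at landing
-- rewrite `import Qw8g10.LefNonNormalField` ↦ `import HodgeCM.Model.Toy.LefNonNormalField`, `import Qw8g10.LefExamples` ↦ `import HodgeCM.Model.Toy.LefExamples`.
/-
Copyright (c) 2026. All rights reserved.
Released under Apache 2.0 license as described in the file LICENSE.
-/
import Mathlib
import Summits.HodgeConjecture.HodgeCM.Model.Toy.LefNonNormalField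
import Summits.HodgeConjecture.HodgeCM.Model.Toy.LefExamples

/-!
# A non-normal quartic CM field, and HC decided for it

`LefNonGenReal` proves that a quartic CM field which is NOT normal over `ℚ` (Galois closure of degree `8`,
group `D₄`) is non-generically-real (`nonGenReal_of_not_normal`) and has cyclic `Aut_ℚ`
(`isCyclic_aut_of_not_normal`), so that the mixing criterion `PartialConj` — hence HC in `lefModel` for products
(`LefPartialConj`) — is decided for it against any partner of degree `≤ 4` by comparing Galois closures.  No such
field was exhibited.  This file CONSTRUCTS one (on top of `LefNonNormalField`: the quartic `X⁴+6X²+7` is irreducible,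
its roots `±α, ±β` are non-real, `β ∉ ℚ(α)`) and decides everything for it, kernel-checked from Mathlib:

* §1 (general) `finrank_le_finrank_galClosure`, `normal_of_finrank_galClosure_le`: a number field is normal as soon
  as its Galois closure (in `ℚ̄ ⊂ ℂ`) has no larger degree; hence the closure of a non-normal field is never
  contained in the closure of a normal field of no larger degree (`not_galClosure_le_of_not_normal`).
* §2 the number field `K = ℚ[X]/(X⁴+6X²+7)` (`KD`, Mathlib's `AdjoinRoot`, wrapped in a `def` so that `algebraRat` is
  its only `ℚ`-algebra structure): degree `4` (`K ≅ ℚ(α)` via the embedding `a ↦ α`), totally complex (every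
  embedding sends the generator to a non-real root), CM (`IsCMField.ofCMExtension` over the totally real quadratic
  subfield `ℚ(s)`, `s = −(a²+3)`, `s² = 2`), bundled as `cmKD : CMField`; and **not normal** (`not_normal_KD`): the
  embeddings `a ↦ α` and `a ↦ β` would have the same image (`galClosure_eq_fieldRange`), forcing `β ∈ ℚ(α)`.
* §3 consequences, all unconditional: `Aut_ℚ(K)` cyclic, `NonGenReal K`, `ClosureExclusive K`; the Galois closure
  of `K` differs from those of `ℚ(ζ₅)`, `ℚ(ζ₈)`, `ℚ(ζ₁₂)`, `ℚ(ζ₃)`, `ℚ(i)`; `PartialConj K ℚ(ζ₅)` (both orders),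
  `PartialConj K ℚ(ζ₃)`, `PartialConj K ℚ(i)`, `PartialConj ℚ(ζ₈) K`, `PartialConj ℚ(ζ₁₂) K`; and the **model
  headlines**: HC in `lefModel` for every product of a CM object with CM by `K` and one with CM by `ℚ(ζ₅)`
  (`lef_hc_cmObj_KD_prod_cmObj_cyc5`, `lef_hc_prod_of_presented_KD_cyc5`), by `ℚ(ζ₃)`, by `ℚ(i)`, and for
  `ℚ(ζ₈) × K`, `ℚ(ζ₁₂) × K` — for ALL CM types.  This is the first decided instance of the criterion whose CM
  field is not abelian over `ℚ`.

Nothing is cited; no data; axioms `[propext, Classical.choice, Quot.sound]` only.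
-/

noncomputable section

open Polynomial Complex IntermediateField Module NumberField

namespace HodgeCM.Toy

open Literature.AlgebraicGeometry.Motives (CMType)

/-! ## §1 Degree of the Galois closure and normality -/

section GalClosureDegree

variable (K : Type) [Field K] [NumberField K]

/-- the Galois closure is at least as big as the field -/
theorem finrank_le_finrank_galClosure : finrank ℚ K ≤ finrank ℚ ↥(galClosure K) := by
  obtain ⟨a⟩ := (inferInstance : Nonempty (K →+* ℂ))
  rw [(equivFieldRange K a).toLinearEquiv.finrank_eq]
  exact IntermediateField.finrank_le_of_le_right (liftA K a).fieldRange_le_normalClosure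

/-- a number field whose Galois closure is no bigger than itself is normal -/
theorem normal_of_finrank_galClosure_le (h : finrank ℚ ↥(galClosure K) ≤ finrank ℚ K) : Normal ℚ K := by
  obtain ⟨a⟩ := (inferInstance : Nonempty (K →+* ℂ))
  have hle : (liftA K a).fieldRange ≤ galClosure K := (liftA K a).fieldRange_le_normalClosure
  have heq : (liftA K a).fieldRange = galClosure K :=
    IntermediateField.eq_of_le_of_finrank_eq hle (le_antisymm (IntermediateField.finrank_le_of_le_right hle)
      (by rw [← (equivFieldRange K a).toLinearEquiv.finrank_eq]; exact h))
  haveI : Normal ℚ ↥(liftA K a).fieldRange := by rw [heq]; infer_instance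
  exact Normal.of_algEquiv (equivFieldRange K a).symm

variable {K}
variable {K₁ K₂ : Type} [Field K₁] [NumberField K₁] [Field K₂] [NumberField K₂]

/-- the Galois closure of a NON-normal field does not fit inside that of a normal field of no larger degree -/
theorem not_galClosure_le_of_not_normal (hn : ¬ Normal ℚ K₁) [Normal ℚ K₂]
    (hd : finrank ℚ K₂ ≤ finrank ℚ K₁) : ¬ galClosure K₁ ≤ galClosure K₂ := fun h =>
  hn (normal_of_finrank_galClosure_le K₁
    ((IntermediateField.finrank_le_of_le_right h).trans ((finrank_galClosure K₂).le.trans hd)))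

/-- (Ported verbatim from the HodgeCMPerL package; no docstring in the source.) -/
theorem galClosure_ne_of_not_normal (hn : ¬ Normal ℚ K₁) [Normal ℚ K₂]
    (hd : finrank ℚ K₂ ≤ finrank ℚ K₁) : galClosure K₁ ≠ galClosure K₂ := fun h =>
  not_galClosure_le_of_not_normal hn hd h.le

end GalClosureDegree

/-! ## §2 The number field `K = ℚ[X]/(X⁴ + 6X² + 7)`: CM and not normal -/

namespace D4

/-- (Ported verbatim from the HodgeCMPerL package; no docstring in the source.) -/
instance quartic_irreducible_fact : Fact (Irreducible quartic) := ⟨quartic_irreducible⟩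

/-- **The field** `K = ℚ[X]/(X⁴ + 6X² + 7) ≅ ℚ(√(−(3+√2)))`.  A `def` (not an `abbrev`), so that the
only `ℚ`-algebra structure Lean finds on it is `algebraRat` (no `AdjoinRoot.instAlgebra` diamond). -/
def KD : Type := AdjoinRoot quartic

/-- (Ported verbatim from the HodgeCMPerL package; no docstring in the source.) -/
instance instField : Field KD := inferInstanceAs (Field (AdjoinRoot quartic))
/-- (Ported verbatim from the HodgeCMPerL package; no docstring in the source.) -/
instance instNumberField : NumberField KD := inferInstanceAs (NumberField (AdjoinRoot quartic))

/-- the generator `a = X mod (X⁴ + 6X² + 7)` -/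
def ra : KD := (AdjoinRoot.root quartic : AdjoinRoot quartic)

/-- (Ported verbatim from the HodgeCMPerL package; no docstring in the source.) -/
theorem ra_quartic : ra ^ 4 + 6 * ra ^ 2 + 7 = 0 := by
  have h := AdjoinRoot.eval₂_root quartic
  rw [eval₂_quartic] at h
  exact h

/-- the embedding `K → ℂ` sending the generator to a prescribed complex root of the quartic -/
def emb (z : ℂ) (hz : z ^ 4 + 6 * z ^ 2 + 7 = 0) : KD →+* ℂ :=
  AdjoinRoot.lift (algebraMap ℚ ℂ) z (by rw [eval₂_quartic]; exact hz)

/-- (Ported verbatim from the HodgeCMPerL package; no docstring in the source.) -/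
theorem emb_ra (z : ℂ) (hz : z ^ 4 + 6 * z ^ 2 + 7 = 0) : emb z hz ra = z := AdjoinRoot.lift_root _

/-- (Ported verbatim from the HodgeCMPerL package; no docstring in the source.) -/
theorem emb_mk (z : ℂ) (hz : z ^ 4 + 6 * z ^ 2 + 7 = 0) (f : ℚ[X]) :
    emb z hz (AdjoinRoot.mk quartic f) = aeval z f := by
  have h : AdjoinRoot.lift (algebraMap ℚ ℂ) z (by rw [eval₂_quartic]; exact hz) (AdjoinRoot.mk quartic f)
      = aeval z f := by
    rw [AdjoinRoot.lift_mk, aeval_def]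
  exact h

/-- (Ported verbatim from the HodgeCMPerL package; no docstring in the source.) -/
theorem emb_mem_adjoin (z : ℂ) (hz : z ^ 4 + 6 * z ^ 2 + 7 = 0) (x : KD) : emb z hz x ∈ ℚ⟮z⟯ := by
  obtain ⟨f, rfl⟩ := AdjoinRoot.mk_surjective (g := quartic) x
  have h := emb_mk z hz f
  refine h ▸ ?_
  exact algebra_adjoin_le_adjoin ℚ _ (aeval_mem_adjoin_singleton ℚ z)

/-- every embedding sends the generator to a (non-real) root of the quartic -/
theorem hom_ra_quartic (φ : KD →+* ℂ) : (φ ra) ^ 4 + 6 * (φ ra) ^ 2 + 7 = 0 := by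
  have h := Polynomial.hom_eval₂ quartic (AdjoinRoot.of quartic) φ (AdjoinRoot.root quartic)
  rw [AdjoinRoot.eval₂_root, map_zero, eval₂_quartic] at h
  exact h.symm

/-- (Ported verbatim from the HodgeCMPerL package; no docstring in the source.) -/
instance isTotallyComplex_KD : IsTotallyComplex KD where
  isComplex v := by
    rw [InfinitePlace.isComplex_iff, ComplexEmbedding.isReal_iff]
    intro h
    exact conj_ne_of_quartic (hom_ra_quartic v.embedding) (by simpa using RingHom.congr_fun h ra)

/-- the embedding `a ↦ z` as a `ℚ`-algebra hom -/
def embA (z : ℂ) (hz : z ^ 4 + 6 * z ^ 2 + 7 = 0) : KD →ₐ[ℚ] ℂ := (emb z hz).toRatAlgHom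

/-- (Ported verbatim from the HodgeCMPerL package; no docstring in the source.) -/
theorem embA_apply (z : ℂ) (hz : z ^ 4 + 6 * z ^ 2 + 7 = 0) (x : KD) : embA z hz x = emb z hz x := rfl

/-- the image of `a ↦ z` is exactly `ℚ(z)` -/
theorem fieldRange_embA (z : ℂ) (hz : z ^ 4 + 6 * z ^ 2 + 7 = 0) : (embA z hz).fieldRange = ℚ⟮z⟯ :=
  le_antisymm (by rintro _ ⟨x, rfl⟩; exact emb_mem_adjoin z hz x)
    (adjoin_simple_le_iff.mpr ⟨ra, emb_ra z hz⟩)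

/-- `K ≅ ℚ(α)` as `ℚ`-algebras -/
def equivAdjoinAl : KD ≃ₐ[ℚ] ↥ℚ⟮al⟯ :=
  ((AlgEquiv.ofInjectiveField (embA al al_quartic)).trans
    (Subalgebra.equivOfEq _ _ ((embA al al_quartic).fieldRange_toSubalgebra).symm)).trans
    (IntermediateField.equivOfEq (fieldRange_embA al al_quartic))

/-- `[K : ℚ] = 4` -/
theorem finrank_KD : finrank ℚ KD = 4 := by
  rw [equivAdjoinAl.toLinearEquiv.finrank_eq, finrank_al]

/-- `s = −(a² + 3)`, a square root of `2` in `K` -/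
def rs : KD := -(ra ^ 2) - 3

/-- (Ported verbatim from the HodgeCMPerL package; no docstring in the source.) -/
theorem rs_sq : rs ^ 2 = 2 := by
  unfold rs; linear_combination ra_quartic

/-- (Ported verbatim from the HodgeCMPerL package; no docstring in the source.) -/
theorem emb_rs (z : ℂ) (hz : z ^ 4 + 6 * z ^ 2 + 7 = 0) : emb z hz rs = -(z ^ 2) - 3 := by
  have h3 : emb z hz 3 = 3 := map_ofNat _ 3
  simp only [rs, map_sub, map_neg, map_pow, emb_ra, h3]

/-- (Ported verbatim from the HodgeCMPerL package; no docstring in the source.) -/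
theorem isIntegral_rs : IsIntegral ℚ rs := by
  refine ⟨X ^ 2 - C 2, monic_X_pow_sub_C _ two_ne_zero, ?_⟩
  simp [rs_sq]

/-- the real quadratic subfield `ℚ(s) ≅ ℚ(√2)` of `K` -/
abbrev E2 : IntermediateField ℚ KD := ℚ⟮rs⟯

/-- `[ℚ(s) : ℚ] = 2` -/
theorem finrank_E2 : finrank ℚ E2 = 2 := by
  have hle : finrank ℚ E2 ≤ 2 := by
    rw [adjoin.finrank isIntegral_rs]
    have h := minpoly.degree_le_of_ne_zero ℚ rs (p := X ^ 2 - C 2) (X_pow_sub_C_ne_zero two_pos _)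
      (by simp [rs_sq])
    rw [degree_X_pow_sub_C two_pos] at h
    exact natDegree_le_iff_degree_le.mpr h
  have hne : finrank ℚ E2 ≠ 1 := by
    intro h1
    have hbot : E2 = ⊥ := finrank_eq_one_iff.mp h1
    have hmem : rs ∈ (⊥ : IntermediateField ℚ KD) := hbot ▸ mem_adjoin_simple_self ℚ rs
    obtain ⟨q, hq⟩ := mem_bot.mp hmem
    apply rt2_ne_ratCast q
    have h := congrArg (emb al al_quartic) hq
    rw [emb_rs, al_sq] at h
    simp only [eq_ratCast, map_ratCast] at h
    rw [h]; ring
  have hpos : 0 < finrank ℚ E2 := finrank_pos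
  omega

/-- `ℚ(s)` is totally real: every embedding sends `s` to `±√2` -/
instance isTotallyReal_E2 : IsTotallyReal E2 where
  isReal w := by
    rw [InfinitePlace.isReal_iff, ComplexEmbedding.isReal_iff]
    set ψ := w.embedding with hψ
    -- the image of the generator is real
    set g : E2 := AdjoinSimple.gen ℚ rs with hg
    have hg2' : g ^ 2 = algebraMap ℚ E2 2 := by
      apply (algebraMap E2 KD).injective
      rw [map_pow, hg, AdjoinSimple.algebraMap_gen, rs_sq, ← IsScalarTower.algebraMap_apply]
      exact (map_ofNat (algebraMap ℚ KD) 2).symm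
    have hg2 : ψ g ^ 2 = 2 := by
      rw [← map_pow, hg2', ← RingHom.comp_apply, map_ofNat]
    have hgreal : (starRingEnd ℂ) (ψ g) = ψ g := by
      have h0 : (ψ g - rt2) * (ψ g + rt2) = 0 := by
        have := rt2_sq; linear_combination hg2 - this
      rcases mul_eq_zero.mp h0 with h | h
      · rw [sub_eq_zero.mp h]; exact rt2_mem_realIF
      · rw [eq_neg_of_add_eq_zero_left h, map_neg]; exact congrArg Neg.neg rt2_mem_realIF
    ext x
    obtain ⟨f, hf⟩ := (adjoin.powerBasis isIntegral_rs).exists_eq_aeval' x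
    rw [adjoin.powerBasis_gen] at hf
    rw [ComplexEmbedding.conjugate_coe_eq, hf, ← hg, aeval_def, hom_eval₂, hom_eval₂, hgreal]
    congr 1
    exact Subsingleton.elim _ _

/-- (Ported verbatim from the HodgeCMPerL package; no docstring in the source.) -/
instance isQuadraticExtension_E2_KD : Algebra.IsQuadraticExtension E2 KD where
  finrank_eq_two' := by
    have h := Module.finrank_mul_finrank ℚ E2 KD
    rw [finrank_E2, finrank_KD] at h
    omega

/-- `K` is a CM field (totally complex, quadratic over the totally real `ℚ(s)`) -/
instance isCMField_KD : IsCMField KD := IsCMField.ofCMExtension E2 KD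

/-- `K` as a `CMField` of the package -/
def cmKD : CMField := ⟨KD⟩

/-- **`K` is not normal over `ℚ`**: the two embeddings `a ↦ α`, `a ↦ β` have different images,
since `β ∉ ℚ(α)`. -/
theorem not_normal_KD : ¬ Normal ℚ KD := by
  intro hN
  have h1 := galClosure_eq_fieldRange KD (emb al al_quartic)
  have h2 := galClosure_eq_fieldRange KD (emb be be_quartic)
  have hmem : liftK (emb be be_quartic) ra ∈ (liftA KD (emb al al_quartic)).fieldRange := by
    rw [← h1, h2]; exact ⟨ra, rfl⟩
  obtain ⟨x, hx⟩ := hmem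
  have hx' : emb al al_quartic x = be := by
    have := congrArg (fun w : Qbar => (w : ℂ)) hx
    simpa [liftA_apply, coe_liftK, emb_ra] using this
  exact be_not_mem_adjoin_al (hx' ▸ emb_mem_adjoin al al_quartic x)

/-! ## §3 Consequences: `NonGenReal K`, partial conjugates, HC decided -/

/-- `Aut_ℚ(K)` is cyclic (of order `2`: `K` is a non-normal quartic) -/
instance isCyclic_aut_KD : IsCyclic (KD ≃ₐ[ℚ] KD) := isCyclic_aut_of_not_normal finrank_KD not_normal_KD

/-- **`K` is non-generically-real** (no real quadratic subfield is hit generically), via non-normality -/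
theorem nonGenReal_KD : NonGenReal KD := nonGenReal_of_not_normal (K := cmKD) finrank_KD not_normal_KD

/-- (Ported verbatim from the HodgeCMPerL package; no docstring in the source.) -/
theorem closureExclusive_KD : ClosureExclusive KD :=
  closureExclusive_of_finrank_le_four cmKD finrank_KD.le nonGenReal_KD

/-- the Galois closure of `K` (degree `8`, group `D₄`) differs from that of every normal field of degree `≤ 4` -/
theorem galClosure_KD_ne_cyc5 : galClosure KD ≠ galClosure (CyclotomicField 5 ℚ) :=
  galClosure_ne_of_not_normal not_normal_KD (by rw [finrank_cyc5, finrank_KD])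

/-- (Ported verbatim from the HodgeCMPerL package; no docstring in the source.) -/
theorem galClosure_KD_ne_cyc8 : galClosure KD ≠ galClosure (CyclotomicField 8 ℚ) :=
  galClosure_ne_of_not_normal not_normal_KD (by rw [finrank_cyc8, finrank_KD])

/-- (Ported verbatim from the HodgeCMPerL package; no docstring in the source.) -/
theorem galClosure_KD_ne_cyc12 : galClosure KD ≠ galClosure (CyclotomicField 12 ℚ) :=
  galClosure_ne_of_not_normal not_normal_KD (by rw [finrank_cyc12, finrank_KD])

/-- (Ported verbatim from the HodgeCMPerL package; no docstring in the source.) -/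
theorem galClosure_KD_ne_cyc3 : galClosure KD ≠ galClosure (CyclotomicField 3 ℚ) :=
  galClosure_ne_of_not_normal not_normal_KD (by rw [finrank_cyc3, finrank_KD]; norm_num)

/-- (Ported verbatim from the HodgeCMPerL package; no docstring in the source.) -/
theorem galClosure_KD_ne_cyc4 : galClosure KD ≠ galClosure (CyclotomicField 4 ℚ) :=
  galClosure_ne_of_not_normal not_normal_KD (by rw [finrank_cyc4, finrank_KD]; norm_num)

/-- **partial conjugates**: `K` with each of `ℚ(ζ₅)`, `ℚ(ζ₃)`, `ℚ(i)` (both orders), and `ℚ(ζ₈)`, `ℚ(ζ₁₂)` with `K` -/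
theorem partialConj_KD_cyc5 : PartialConj KD (CyclotomicField 5 ℚ) :=
  (partialConj_iff_galClosure_ne cmKD (cyc 5) finrank_KD.le finrank_cyc5.le nonGenReal_KD nonGenReal_cyc5).mpr
    galClosure_KD_ne_cyc5

/-- (Ported verbatim from the HodgeCMPerL package; no docstring in the source.) -/
theorem partialConj_cyc5_KD : PartialConj (CyclotomicField 5 ℚ) KD :=
  (partialConj_iff_galClosure_ne (cyc 5) cmKD finrank_cyc5.le finrank_KD.le nonGenReal_cyc5 nonGenReal_KD).mpr
    galClosure_KD_ne_cyc5.symm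

/-- (Ported verbatim from the HodgeCMPerL package; no docstring in the source.) -/
theorem partialConj_KD_cyc3 : PartialConj KD (CyclotomicField 3 ℚ) :=
  (partialConj_iff_galClosure_ne cmKD (cyc 3) finrank_KD.le (finrank_cyc3.le.trans (by norm_num))
    nonGenReal_KD nonGenReal_cyc3).mpr galClosure_KD_ne_cyc3

/-- (Ported verbatim from the HodgeCMPerL package; no docstring in the source.) -/
theorem partialConj_KD_cyc4 : PartialConj KD (CyclotomicField 4 ℚ) :=
  (partialConj_iff_galClosure_ne cmKD (cyc 4) finrank_KD.le (finrank_cyc4.le.trans (by norm_num))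
    nonGenReal_KD nonGenReal_cyc4).mpr galClosure_KD_ne_cyc4

/-- (Ported verbatim from the HodgeCMPerL package; no docstring in the source.) -/
theorem partialConj_cyc8_KD : PartialConj (CyclotomicField 8 ℚ) KD :=
  partialConj_of_closureExclusive closureExclusive_KD
    (not_galClosure_le_of_not_normal not_normal_KD (by rw [finrank_cyc8, finrank_KD]))

/-- (Ported verbatim from the HodgeCMPerL package; no docstring in the source.) -/
theorem partialConj_cyc12_KD : PartialConj (CyclotomicField 12 ℚ) KD :=
  partialConj_of_closureExclusive closureExclusive_KD
    (not_galClosure_le_of_not_normal not_normal_KD (by rw [finrank_cyc12, finrank_KD]))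

/-- **HEADLINE (HC decided for a non-normal CM field).** Every product of a CM object with CM by the dihedral
quartic CM field `K = ℚ[X]/(X⁴+6X²+7)` and a CM object with CM by `ℚ(ζ₅)` satisfies HC in `lefModel`, for every
pair of CM types. -/
theorem lef_hc_cmObj_KD_prod_cmObj_cyc5 (Φ : CMType cmKD) (Φ' : CMType (cyc 5)) :
    lefModel.HC ((cmObj cmKD Φ).prod (cmObj (cyc 5) Φ')) :=
  lef_hc_cmObj_prod_cmObj cmKD (cyc 5) finrank_KD.le finrank_cyc5.le partialConj_KD_cyc5 Φ Φ'

/-- (Ported verbatim from the HodgeCMPerL package; no docstring in the source.) -/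
theorem lef_hc_prod_of_presented_KD_cyc5 {X Y : Obj} (hX : X.Presented cmKD) (hY : Y.Presented (cyc 5)) :
    lefModel.HC (X.prod Y) :=
  lef_hc_prod_of_presented_of_presented cmKD (cyc 5) finrank_KD.le finrank_cyc5.le partialConj_KD_cyc5 hX hY

/-- … with CM elliptic curves `ℚ(ζ₃)`, `ℚ(i)` -/
theorem lef_hc_cmObj_KD_prod_cmObj_cyc3 (Φ : CMType cmKD) (Φ' : CMType (cyc 3)) :
    lefModel.HC ((cmObj cmKD Φ).prod (cmObj (cyc 3) Φ')) :=
  lef_hc_cmObj_prod_cmObj cmKD (cyc 3) finrank_KD.le (finrank_cyc3.le.trans (by norm_num)) partialConj_KD_cyc3 Φ Φ'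

/-- (Ported verbatim from the HodgeCMPerL package; no docstring in the source.) -/
theorem lef_hc_cmObj_KD_prod_cmObj_cyc4 (Φ : CMType cmKD) (Φ' : CMType (cyc 4)) :
    lefModel.HC ((cmObj cmKD Φ).prod (cmObj (cyc 4) Φ')) :=
  lef_hc_cmObj_prod_cmObj cmKD (cyc 4) finrank_KD.le (finrank_cyc4.le.trans (by norm_num)) partialConj_KD_cyc4 Φ Φ'

/-- … and with the biquadratic `ℚ(ζ₈)`, `ℚ(ζ₁₂)` (which are NOT non-generically-real) on the left -/
theorem lef_hc_cmObj_cyc8_prod_cmObj_KD (Φ : CMType (cyc 8)) (Φ' : CMType cmKD) :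
    lefModel.HC ((cmObj (cyc 8) Φ).prod (cmObj cmKD Φ')) :=
  lef_hc_cmObj_prod_cmObj (cyc 8) cmKD finrank_cyc8.le finrank_KD.le partialConj_cyc8_KD Φ Φ'

/-- (Ported verbatim from the HodgeCMPerL package; no docstring in the source.) -/
theorem lef_hc_cmObj_cyc12_prod_cmObj_KD (Φ : CMType (cyc 12)) (Φ' : CMType cmKD) :
    lefModel.HC ((cmObj (cyc 12) Φ).prod (cmObj cmKD Φ')) :=
  lef_hc_cmObj_prod_cmObj (cyc 12) cmKD finrank_cyc12.le finrank_KD.le partialConj_cyc12_KD Φ Φ'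

end D4

end HodgeCM.Toy
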